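import Literature.Computability.Complexity.GateEliminationRules23

/-!
# Gate elimination, VIII: the potential transfer lemma; Rule 1 with coinciding wires; Rule 5

Fourth layer of the toolkit for the one-step claim `LiYang2022_step` (Li–Yang, STOC 2022;
full version ECCC TR21-023, §3.3 and Lemma 3.11), continuing `GateEliminationRules23.lean`.
Everything is PROVED.

* `GoodCover`, **`exists_packing_transfer`** — the count shared by all normalization rules,
  abstracted: if the gates of `C'` embed into those of `C`, the packs of a packing `𝒫` of `C` lie
  in the image with adjacencies surviving, and every *new* troubled gate of `C'` lies in
  `A ∪ B` for two good sets (at most one gate, or an adjacent troubled pair), then `C'` has a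
  packing `𝒫'` with `Φ(C', 𝒫') ≤ Φ(C, 𝒫) + [A ≠ ∅] + [B ≠ ∅]`.
* `CausedBy`, `goodCover_causedBy` — the troubled gates *caused by* one node of `C` (the node is
  the gate itself, or a variable it reads) form a good set; this is the content of "newly
  introduced troubled gates can only be `I₁`, `I₂`, or the gates fed by them".
* Rule 1 revisited: `exists_packing_removeGate_le` (`Φ' ≤ Φ + 1` when the two wires of the
  deleted `0`-gate coincide or one is a constant, `+ 2` otherwise) and `rule1_of_coincide`
  (`Δμ ≥ 1 - α_φ`).
* Bypass revisited: `fanout_bypass_add`, `causedBy_of_new_troubled_bypass`,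
  `exists_packing_bypass_le` (`Φ' ≤ Φ + 1` when the other wire coincides with the target or is a
  constant, `+ 2` otherwise), `influential_bypass_subset'`.
* **Rule 5** (`rule5`): a gate whose two wires go to the same node (not itself, not the output)
  is eliminated with `Δμ ≥ 1 - α_φ` — via the constant it computes and Rule 1 if `t ↦ op t t` is
  constant (`troubled_redirect_const_iff'`, `measure_redirect_const'` for a non-troubled gate),
  via `bypass` otherwise.

Still deferred: Rules 2, 3, 5 when the gate is the output; Rule 4 (useless gates); gates reading
themselves (possible in the xor-part only with a gate as the other input).

## References

* J. Li, T. Yang, *3.1n − o(n) circuit lower bounds for explicit functions*, STOC 2022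
  [LiYang2022]; full version ECCC TR21-023, §3.3 (Rules 1–5), Prop. 3.10, Lemma 3.11.
-/

namespace Literature.Computability.Complexity

open Finset

namespace Semicircuit

variable {n : ℕ}

/-- A set of gates is *good* for the potential count if it has at most one element or is a pair
of adjacent troubled gates (which can be packed). [cite: LiYang2022, §3.3] -/
def GoodCover (D : Semicircuit n) (A : Finset (Fin D.m)) : Prop :=
  A.card ≤ 1 ∨ ∃ u v, u ≠ v ∧ A = {u, v} ∧ D.Troubled u ∧ D.Troubled v ∧ D.Adjacent u v

/-- A subset of a good set is good. [folklore] -/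
theorem GoodCover.subset {D : Semicircuit n} {A A' : Finset (Fin D.m)} (h : D.GoodCover A) (hsub : A' ⊆ A) :
    D.GoodCover A' := by
  classical
  rcases h with h | ⟨u, v, huv, rfl, hu, hv, hadj⟩
  · exact Or.inl ((card_le_card hsub).trans h)
  · by_cases heq : A' = {u, v}
    · exact Or.inr ⟨u, v, huv, heq, hu, hv, hadj⟩
    · left
      have hlt : A'.card < ({u, v} : Finset _).card := card_lt_card (hsub.ssubset_of_ne heq)
      rw [card_pair huv] at hlt
      omega

/-- **Potential transfer lemma** (the common count behind Li–Yang's normalization rules, §3.3):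
let `C'` arise from `C` with its gates embedded by `ι` into those of `C` (the kept gates), let `𝒫`
be a packing of `C` by kept gates whose adjacencies survive in `C'` (asked only of pairs still
troubled in `C'`), and suppose every *new*
troubled gate of `C'` (troubled, but `ι k` was not) lies in `A ∪ B` for two good sets `A`, `B`.
Then `C'` has a packing `𝒫'` with `Φ(C', 𝒫') ≤ Φ(C, 𝒫) + [A ≠ ∅] + [B ≠ ∅]`: the old packs
whose gates stay troubled are kept (dropped packs inject into gates that stopped being troubled,
`card_add_card_sdiff_ge_of_pairwise`), and the new troubled gates are packed by
`exists_pairs_cover`. [cite: LiYang2022, §3.3 (Rules 1–5), Prop. 3.10] -/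
theorem exists_packing_transfer (C C' : Semicircuit n) (ι : Fin C'.m → Fin C.m)
    (hι : Function.Injective ι) {P : Finset (Fin C.m × Fin C.m)} (hP : C.IsPacking P)
    (himg : ∀ p ∈ P, (∃ k, ι k = p.1) ∧ ∃ k, ι k = p.2)
    (hadj : ∀ k k', C'.Troubled k → C'.Troubled k' → C.Troubled (ι k) → C.Troubled (ι k') →
      C.Adjacent (ι k) (ι k') → C'.Adjacent k k')
    (A B : Finset (Fin C'.m))
    (hcover : ∀ k, C'.Troubled k → ¬ C.Troubled (ι k) → k ∈ A ∨ k ∈ B)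
    (hA : C'.GoodCover A) (hB : C'.GoodCover B) :
    ∃ P' : Finset (Fin C'.m × Fin C'.m), C'.IsPacking P' ∧
      C'.potential P' ≤ C.potential P + (if A = ∅ then 0 else 1 : ℕ) + (if B = ∅ then 0 else 1 : ℕ) := by
  classical
  set T' : Finset (Fin C'.m) := univ.filter fun k => C'.Troubled k with hT'
  set Told : Finset (Fin C'.m) := univ.filter fun k => C.Troubled (ι k) with hTold
  set N : Finset (Fin C'.m) := T' \ Told with hN
  set Pm : Finset (Fin C'.m × Fin C'.m) := univ.filter fun q => (ι q.1, ι q.2) ∈ P with hPm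
  set Pold : Finset (Fin C'.m × Fin C'.m) := Pm.filter fun q => q.1 ∈ T' ∧ q.2 ∈ T' with hPold
  -- (1) `|Pm| = |P|`
  let emb : (Fin C'.m × Fin C'.m) ↪ (Fin C.m × Fin C.m) :=
    ⟨fun q => (ι q.1, ι q.2), fun q q' h => by
      simp only [Prod.mk.injEq] at h
      exact Prod.ext (hι h.1) (hι h.2)⟩
  have hPeq : P = Pm.map emb := by
    ext p
    rw [mem_map]
    constructor
    · intro hp
      obtain ⟨⟨k₁, hk₁⟩, ⟨k₂, hk₂⟩⟩ := himg p hp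
      refine ⟨(k₁, k₂), ?_, ?_⟩
      · rw [hPm, mem_filter]
        refine ⟨mem_univ _, ?_⟩
        simp only [hk₁, hk₂, Prod.mk.eta, hp]
      · simp only [emb, Function.Embedding.coeFn_mk, hk₁, hk₂, Prod.mk.eta]
    · rintro ⟨q, hq, rfl⟩
      rw [hPm, mem_filter] at hq
      exact hq.2
  have hPm_card : Pm.card = P.card := by rw [hPeq, card_map]
  -- (2) dropped packs inject into un-troubled gates
  have hPmT : ∀ q ∈ Pm, q.1 ∈ Told ∧ q.2 ∈ Told := by
    intro q hq
    rw [hPm, mem_filter] at hq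
    obtain ⟨-, hT1, hT2, -⟩ := hP.1 _ hq.2
    simp [hTold, hT1, hT2]
  have hPm_dis : ∀ q ∈ Pm, ∀ q' ∈ Pm, q ≠ q' →
      q.1 ≠ q'.1 ∧ q.1 ≠ q'.2 ∧ q.2 ≠ q'.1 ∧ q.2 ≠ q'.2 := by
    intro q hq q' hq' hne
    rw [hPm, mem_filter] at hq hq'
    have hne' : emb q ≠ emb q' := fun h => hne (emb.injective h)
    have hd := hP.2 _ hq.2 _ hq'.2 hne'
    refine ⟨fun h => hd.1 (by rw [h]), fun h => hd.2.1 (by rw [h]), fun h => hd.2.2.1 (by rw [h]),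
      fun h => hd.2.2.2 (by rw [h])⟩
  have hdrop : Pm.card ≤ Pold.card + (Told \ T').card :=
    card_add_card_sdiff_ge_of_pairwise Pm Told T' hPmT hPm_dis
  -- (3) cover the new troubled gates by `A ∩ N` and `B ∩ N`
  have hNT' : N ⊆ T' := sdiff_subset
  have hT'mem : ∀ k, k ∈ T' ↔ C'.Troubled k := fun k => by simp [hT']
  set A' := A ∩ N with hA'
  set B' := B ∩ N with hB'
  have hNcov : N ⊆ A' ∪ B' := by
    intro k hk
    have hk' := hk
    rw [hN, mem_sdiff, hT'mem] at hk'
    have hkT : ¬ C.Troubled (ι k) := fun h => hk'.2 (by simp [hTold, h])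
    rw [mem_union, hA', hB', mem_inter, mem_inter]
    rcases hcover k hk'.1 hkT with h | h
    · exact Or.inl ⟨h, hk⟩
    · exact Or.inr ⟨h, hk⟩
  let Adj : Fin C'.m → Fin C'.m → Prop := fun u w => C'.Troubled u ∧ C'.Troubled w ∧ C'.Adjacent u w
  have hgood : ∀ {X : Finset (Fin C'.m)}, C'.GoodCover X →
      X.card ≤ 1 ∨ ∃ u w, u ≠ w ∧ X = {u, w} ∧ Adj u w := by
    intro X h
    rcases h with h | ⟨u, w, huw, rfl, hu, hw, hadj⟩
    · exact Or.inl h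
    · exact Or.inr ⟨u, w, huw, rfl, hu, hw, hadj⟩
  have hQN : ∀ p ∈ Pold, p.1 ∉ N ∧ p.2 ∉ N := by
    intro p hp
    have hp' := hPmT p (filter_subset _ _ hp)
    rw [hN]
    exact ⟨fun h => (mem_sdiff.mp h).2 hp'.1, fun h => (mem_sdiff.mp h).2 hp'.2⟩
  obtain ⟨Q', hsubQ, hcardN, hnew, hnewdis⟩ := exists_pairs_cover Adj Pold N A' B' hNcov
    (hgood (hA.subset inter_subset_left)) (hgood (hB.subset inter_subset_left))
    inter_subset_right inter_subset_right hQN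
  -- (4) `Q'` is a packing of `C'`
  have hPoldPm : Pold ⊆ Pm := filter_subset _ _
  refine ⟨Q', ⟨fun p hp => ?_, fun p hp p' hp' hne => ?_⟩, ?_⟩
  · by_cases hpo : p ∈ Pold
    · have hpm := hPoldPm hpo
      rw [hPold, mem_filter] at hpo
      rw [hPm, mem_filter] at hpm
      obtain ⟨hne, hT1, hT2, hadjC⟩ := hP.1 _ hpm.2
      refine ⟨fun h => hne (by rw [h]), (hT'mem _).mp hpo.2.1, (hT'mem _).mp hpo.2.2, ?_⟩
      exact hadj p.1 p.2 ((hT'mem _).mp hpo.2.1) ((hT'mem _).mp hpo.2.2) hT1 hT2 hadjC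
    · obtain ⟨hne, -, -, hT1, hT2, hadj'⟩ := hnew p (mem_sdiff.mpr ⟨hp, hpo⟩)
      exact ⟨hne, hT1, hT2, hadj'⟩
  · by_cases hpo : p ∈ Pold <;> by_cases hpo' : p' ∈ Pold
    · exact hPm_dis p (hPoldPm hpo) p' (hPoldPm hpo') hne
    · have ho := hPmT p (hPoldPm hpo)
      obtain ⟨-, hn1, hn2, -⟩ := hnew p' (mem_sdiff.mpr ⟨hp', hpo'⟩)
      rw [hN, mem_sdiff] at hn1 hn2
      exact ⟨fun h => hn1.2 (h ▸ ho.1), fun h => hn2.2 (h ▸ ho.1), fun h => hn1.2 (h ▸ ho.2),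
        fun h => hn2.2 (h ▸ ho.2)⟩
    · have ho := hPmT p' (hPoldPm hpo')
      obtain ⟨-, hn1, hn2, -⟩ := hnew p (mem_sdiff.mpr ⟨hp, hpo⟩)
      rw [hN, mem_sdiff] at hn1 hn2
      exact ⟨fun h => hn1.2 (h ▸ ho.1), fun h => hn1.2 (h ▸ ho.2), fun h => hn2.2 (h ▸ ho.1),
        fun h => hn2.2 (h ▸ ho.2)⟩
    · exact hnewdis p (mem_sdiff.mpr ⟨hp, hpo⟩) p' (mem_sdiff.mpr ⟨hp', hpo'⟩) hne
  · -- (5) the count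
    have hT'card : N.card + (T' ∩ Told).card = T'.card := card_sdiff_add_card_inter T' Told
    have hToldsplit : (Told \ T').card + (Told ∩ T').card = Told.card := card_sdiff_add_card_inter Told T'
    have hinter : T' ∩ Told = Told ∩ T' := inter_comm _ _
    have hTold_le : Told.card ≤ C.troubledCount := by
      unfold troubledCount
      refine card_le_card_of_injOn ι (fun k hk => ?_) fun k _ k' _ h => hι h
      simpa [hTold] using hk
    have hPold_le : Pold.card ≤ Q'.card := card_le_card hsubQ
    have ht' : C'.troubledCount = T'.card := by
      unfold troubledCount; rw [hT']
    unfold potential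
    rw [ht']
    rw [hinter] at hT'card
    have hiA : (if A' = ∅ then 0 else 1) ≤ (if A = ∅ then 0 else 1 : ℕ) := by
      by_cases h : A = ∅
      · rw [if_pos h, if_pos (by rw [hA', h, empty_inter])]
      · rw [if_neg h]; split_ifs <;> omega
    have hiB : (if B' = ∅ then 0 else 1) ≤ (if B = ∅ then 0 else 1 : ℕ) := by
      by_cases h : B = ∅
      · rw [if_pos h, if_pos (by rw [hB', h, empty_inter])]
      · rw [if_neg h]; split_ifs <;> omega
    have hnat : T'.card + P.card ≤ C.troubledCount + Q'.card +
        (if A = ∅ then 0 else 1 : ℕ) + (if B = ∅ then 0 else 1 : ℕ) := by omega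
    have hreal : (T'.card : ℝ) + P.card ≤ C.troubledCount + Q'.card +
        ((if A = ∅ then 0 else 1 : ℕ) : ℝ) + ((if B = ∅ then 0 else 1 : ℕ) : ℝ) := by exact_mod_cast hnat
    linarith

/-- The indicator of a nonempty set is at most one. [folklore] -/
theorem ite_empty_le_one {α : Type*} [DecidableEq α] (A : Finset α) : (if A = ∅ then 0 else 1 : ℕ) ≤ 1 := by
  split_ifs <;> omega

/-- At most `fanout` troubled gates read a node, and they are pairwise adjacent when it is a
variable: the readers of a `2`-variable form a good set. More precisely: a set of troubled gates
all reading the variable `z` is good. [cite: LiYang2022, §3.3] -/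
theorem goodCover_of_reads (D : Semicircuit n) (A : Finset (Fin D.m)) (z : Fin n)
    (hA : ∀ k ∈ A, D.Troubled k ∧ ∃ a, D.arg k a = .var z) : D.GoodCover A := by
  classical
  by_cases hne : A.Nonempty
  · obtain ⟨k₁, hk₁⟩ := hne
    obtain ⟨hT₁, a₁, ha₁⟩ := hA k₁ hk₁
    -- `z` is a `2`-variable
    have hfz : D.fanout (.var z) = 2 := by
      obtain ⟨-, -, x, y, -, hr, hx, hy⟩ := hT₁
      have : (Node.var z : Node n D.m) ∈ Set.range (D.arg k₁) := ⟨a₁, ha₁⟩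
      rw [hr] at this
      rcases this with h | h
      · rw [Node.var.injEq] at h; rw [h]; exact hx
      · rw [Set.mem_singleton_iff, Node.var.injEq] at h; rw [h]; exact hy
    have hsub : A ⊆ univ.filter fun k => ∃ a, D.arg k a = .var z :=
      fun k hk => mem_filter.mpr ⟨mem_univ _, (hA k hk).2⟩
    have hcard2 : A.card ≤ 2 :=
      (card_le_card hsub).trans ((D.card_readers_le_fanout (.var z)).trans hfz.le)
    rcases Nat.lt_or_ge A.card 2 with hlt | hge
    · left; omega
    · right
      obtain ⟨u, w, huw, huwA⟩ := card_eq_two.mp (le_antisymm hcard2 hge)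
      have hu := hA u (by rw [huwA]; simp)
      have hw := hA w (by rw [huwA]; simp)
      exact ⟨u, w, huw, huwA, hu.1, hw.1, D.adjacent_of_reads hu.2 hw.2⟩
  · left
    rw [not_nonempty_iff_eq_empty.mp hne, card_empty]
    exact zero_le_one

/-- A set of pairwise equal gates is good. [folklore] -/
theorem goodCover_of_subsingleton (D : Semicircuit n) (A : Finset (Fin D.m))
    (hA : ∀ k ∈ A, ∀ k' ∈ A, k = k') : D.GoodCover A :=
  Or.inl (card_le_one.mpr hA)


/-! ### New troubled gates caused by a node -/

/-- The troubledness of gate `k` of `D` (whose gates embed into those of `C` by `ι`) is *caused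
by* the node `u` of `C`: `u` is the gate `ι k` itself, or a variable read by `k`. New troubled
gates of the normalization rules are caused by the inputs of the eliminated gate
(Li–Yang §3.3: "newly introduced troubled gate can only be `I₁`, `I₂`, or the gates fed by them").
[cite: LiYang2022, §3.3] -/
def CausedBy (C D : Semicircuit n) (ι : Fin D.m → Fin C.m) (u : Node n C.m) (k : Fin D.m) : Prop :=
  u = .gate (ι k) ∨ ∃ z, u = .var z ∧ ∃ a, D.arg k a = .var z

/-- **The troubled gates caused by one node form a good set**: at most one if the node is a
gate, at most two adjacent ones if it is a variable (then a `2`-variable), none if a constant.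
[cite: LiYang2022, §3.3] -/
theorem goodCover_causedBy (C D : Semicircuit n) (ι : Fin D.m → Fin C.m) (hι : Function.Injective ι)
    (u : Node n C.m) (A : Finset (Fin D.m)) (hA : ∀ k ∈ A, D.Troubled k ∧ CausedBy C D ι u k) :
    D.GoodCover A := by
  cases u with
  | const b =>
    refine D.goodCover_of_subsingleton _ fun k hk k' _ => ?_
    rcases (hA k hk).2 with h | ⟨z, h, -⟩ <;> cases h
  | gate g =>
    refine D.goodCover_of_subsingleton _ fun k hk k' hk' => ?_
    rcases (hA k hk).2 with h | ⟨z, h, -⟩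
    · rcases (hA k' hk').2 with h' | ⟨z, h', -⟩
      · exact hι ((Node.gate.inj h).symm.trans (Node.gate.inj h'))
      · cases h'
    · cases h
  | var z =>
    refine D.goodCover_of_reads _ z fun k hk => ⟨(hA k hk).1, ?_⟩
    rcases (hA k hk).2 with h | ⟨z', h, hr⟩
    · cases h
    · rw [Node.var.injEq] at h; subst h; exact hr

/-! ### Rule 1 revisited through the transfer lemma: coinciding wires give `ΔΦ ≤ 1` -/

section Rule1Coincide

variable (C : Semicircuit n) (k₀ : Fin C.m) {m' : ℕ} (ε : Fin m' ≃ {k : Fin C.m // k ≠ k₀})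

/-- New troubled gates after deleting a `0`-gate are caused by one of its two inputs
(`near_of_new_troubled`, rephrased). [cite: LiYang2022, §3.3 (Rule 1)] -/
theorem causedBy_of_new_troubled_removeGate (h0 : ∀ k a, C.arg k a ≠ .gate k₀) {k : Fin m'}
    (hT' : (C.removeGate k₀ ε).Troubled k) (hT : ¬ C.Troubled (ε k)) :
    ∃ a, CausedBy C (C.removeGate k₀ ε) (fun k => (ε k : Fin C.m)) (C.arg k₀ a) k := by
  obtain ⟨a, ha⟩ := C.near_of_new_troubled k₀ ε h0 hT' hT
  refine ⟨a, ?_⟩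
  rcases ha with ha | ⟨z, hz, hr⟩
  · exact Or.inl ha
  · exact Or.inr ⟨z, hz, (C.reads_var_removeGate_iff k₀ ε k z).mpr hr⟩

/-- **Rule 1 with the transfer lemma**: deleting a `0`-gate gives `Φ' ≤ Φ + 2` in general and
`Φ' ≤ Φ + 1` when its two wires go to the same node (or one of them is a constant).
[cite: LiYang2022, §3.3 (Rules 1, 5)] -/
theorem exists_packing_removeGate_le (h0 : ∀ k a, C.arg k a ≠ .gate k₀)
    {P : Finset (Fin C.m × Fin C.m)} (hP : C.IsPacking P) :
    ∃ P' : Finset (Fin m' × Fin m'), (C.removeGate k₀ ε).IsPacking P' ∧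
      (C.removeGate k₀ ε).potential P' ≤ C.potential P +
        (if C.arg k₀ 0 = C.arg k₀ 1 ∨ (∃ b, C.arg k₀ 0 = .const b) ∨ (∃ b, C.arg k₀ 1 = .const b)
          then 1 else 2) := by
  classical
  set C' := C.removeGate k₀ ε
  set ι : Fin m' → Fin C.m := fun k => (ε k : Fin C.m) with hι
  have hιinj : Function.Injective ι := fun k k' h => ε.injective (Subtype.ext h)
  have hk₀T : ¬ C.Troubled k₀ := fun h => by
    have := h.fanout_eq
    rw [(C.fanout_eq_zero_iff _).mpr h0] at this
    exact zero_ne_one this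
  have himg : ∀ p ∈ P, (∃ k, ι k = p.1) ∧ ∃ k, ι k = p.2 := by
    intro p hp
    obtain ⟨-, hT1, hT2, -⟩ := hP.1 p hp
    have h1 : p.1 ≠ k₀ := fun h => hk₀T (h ▸ hT1)
    have h2 : p.2 ≠ k₀ := fun h => hk₀T (h ▸ hT2)
    exact ⟨⟨ε.symm ⟨p.1, h1⟩, by simp [hι]⟩, ⟨ε.symm ⟨p.2, h2⟩, by simp [hι]⟩⟩
  have hadj : ∀ k k', C'.Troubled k → C'.Troubled k' → C.Troubled (ι k) → C.Troubled (ι k') →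
      C.Adjacent (ι k) (ι k') → C'.Adjacent k k' := fun k k' _ _ _ _ h => C.adjacent_removeGate_of k₀ ε k k' h
  -- cover sets: troubled gates caused by each input
  set A : Finset (Fin m') := univ.filter fun k => C'.Troubled k ∧ CausedBy C C' ι (C.arg k₀ 0) k with hA
  set B : Finset (Fin m') := univ.filter fun k => C'.Troubled k ∧ CausedBy C C' ι (C.arg k₀ 1) k with hB
  have hAgood : C'.GoodCover A := goodCover_causedBy C C' ι hιinj _ A fun k hk => (mem_filter.mp hk).2
  have hBgood : C'.GoodCover B := goodCover_causedBy C C' ι hιinj _ B fun k hk => (mem_filter.mp hk).2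
  have hcover : ∀ k, C'.Troubled k → ¬ C.Troubled (ι k) → k ∈ A ∨ k ∈ B := by
    intro k hk hkT
    obtain ⟨a, ha⟩ := C.causedBy_of_new_troubled_removeGate k₀ ε h0 hk hkT
    obtain rfl | rfl : a = 0 ∨ a = 1 := by fin_cases a <;> simp
    · exact Or.inl (mem_filter.mpr ⟨mem_univ _, hk, ha⟩)
    · exact Or.inr (mem_filter.mpr ⟨mem_univ _, hk, ha⟩)
  split_ifs with hcase
  · -- one cover set suffices
    have hcover' : ∀ k, C'.Troubled k → ¬ C.Troubled (ι k) → k ∈ (A ∪ B) ∨ k ∈ (∅ : Finset (Fin m')) :=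
      fun k hk hkT => Or.inl (mem_union.mpr (hcover k hk hkT))
    have hgood : C'.GoodCover (A ∪ B) := by
      rcases hcase with heq | ⟨b, hb⟩ | ⟨b, hb⟩
      · have : B = A := by rw [hA, hB, heq]
        rw [this, union_idempotent]; exact hAgood
      · have : A = ∅ := by
          rw [hA, filter_eq_empty_iff]
          rintro k - ⟨-, h | ⟨z, h, -⟩⟩ <;> rw [hb] at h <;> cases h
        rw [this, empty_union]; exact hBgood
      · have : B = ∅ := by
          rw [hB, filter_eq_empty_iff]
          rintro k - ⟨-, h | ⟨z, h, -⟩⟩ <;> rw [hb] at h <;> cases h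
        rw [this, union_empty]; exact hAgood
    obtain ⟨P', hP', hpot⟩ := exists_packing_transfer C C' ι hιinj hP himg hadj (A ∪ B) ∅ hcover' hgood
      (Or.inl (by simp))
    refine ⟨P', hP', hpot.trans ?_⟩
    have h1 : ((if A ∪ B = ∅ then 0 else 1 : ℕ) : ℝ) ≤ 1 := by exact_mod_cast ite_empty_le_one (A ∪ B)
    have h2 : ((if (∅ : Finset (Fin m')) = ∅ then 0 else 1 : ℕ) : ℝ) = 0 := by simp
    linarith
  · obtain ⟨P', hP', hpot⟩ := exists_packing_transfer C C' ι hιinj hP himg hadj A B hcover hAgood hBgood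
    refine ⟨P', hP', hpot.trans ?_⟩
    have hA1 : ((if A = ∅ then 0 else 1 : ℕ) : ℝ) ≤ 1 := by exact_mod_cast ite_empty_le_one A
    have hB1 : ((if B = ∅ then 0 else 1 : ℕ) : ℝ) ≤ 1 := by exact_mod_cast ite_empty_le_one B
    linarith

/-- **Rule 1 for a `0`-gate with coinciding wires** (as arises in Rule 5): `Δμ ≥ 1 - α_φ`.
[cite: LiYang2022, Lemma 3.11 (Rules 1, 5)] -/
theorem rule1_of_coincide {f : (Fin n → ZMod 2) → Bool} {R : RdqSource n} (hF : C.Fair)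
    (hC : C.ComputesRestr f R) {P : Finset (Fin C.m × Fin C.m)} (hP : C.IsPacking P)
    (h0 : C.fanout (.gate k₀) = 0) (hout : C.out ≠ .gate k₀) (hco : C.arg k₀ 0 = C.arg k₀ 1)
    {αφ αI : ℝ} (hφ : 0 ≤ αφ) (hI : 0 ≤ αI) (αQ : ℝ) :
    ∃ (C' : Semicircuit n) (P' : Finset (Fin C'.m × Fin C'.m)), C'.Fair ∧ C'.ComputesRestr f R ∧
      C'.IsPacking P' ∧ C'.m + 1 = C.m ∧
      C'.measure αφ αI αQ P' R ≤ C.measure αφ αI αQ P R - (1 - αφ) := by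
  have h0' := (C.fanout_eq_zero_iff _).mp h0
  set ε := C.skipEquiv k₀
  obtain ⟨P', hP', hpot⟩ := C.exists_packing_removeGate_le k₀ ε h0' hP
  rw [if_pos (Or.inl hco)] at hpot
  refine ⟨C.removeGate k₀ ε, P', hF.removeGate ε h0', hC.removeGate ε hF h0' hout, hP',
    C.removeGate_m_add_one k₀ ε, ?_⟩
  have hinf : (((C.removeGate k₀ ε).influential R).card : ℝ) ≤ (C.influential R).card := by
    exact_mod_cast card_le_card (C.influential_removeGate_subset k₀ ε h0' R)
  have hm : (((C.m - 1 : ℕ)) : ℝ) + 1 = C.m := by exact_mod_cast C.removeGate_m_add_one k₀ ε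
  unfold measure
  show ((C.m - 1 : ℕ) : ℝ) + _ + _ + _ ≤ _
  nlinarith [mul_le_mul_of_nonneg_left hinf hI, mul_le_mul_of_nonneg_left hpot hφ]

end Rule1Coincide
end Semicircuit

/-! ### Normalization Rule 5: a gate whose two wires coincide -/

namespace Semicircuit

section Rule5

variable {n : ℕ} (C : Semicircuit n) (k₀ : Fin C.m)

/-- Redirecting the wires of a non-troubled gate to a constant does not change the troubled
gates (generalizes `troubled_redirect_const_iff`). [cite: LiYang2022, §3.3 (Rules 2, 5)] -/
theorem troubled_redirect_const_iff' (hk₀ : ¬ C.Troubled k₀) (c neg : Bool) (k : Fin C.m) :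
    (C.redirect k₀ (.const c) neg (C.redirectOK_const k₀ c)).Troubled k ↔ C.Troubled k := by
  set hv := C.redirectOK_const k₀ c
  by_cases hk : ∃ a, C.arg k a = .gate k₀
  · obtain ⟨a, ha⟩ := hk
    have h1 : (C.redirect k₀ (.const c) neg hv).arg k a = .const c := by
      rw [redirect_arg, if_pos ha]
    exact ⟨fun h => absurd h (not_troubled_of_reads_const h1),
      fun h => absurd h (not_troubled_of_reads_gate ha)⟩
  · push Not at hk
    have hargs : (C.redirect k₀ (.const c) neg hv).arg k = C.arg k := by
      funext a; rw [redirect_arg, if_neg (hk a)]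
    by_cases hkk : k = k₀
    · subst hkk
      refine ⟨fun h => ?_, fun h => absurd h hk₀⟩
      have := h.fanout_eq
      rw [C.fanout_redirect_self k (.const c) neg hv (fun h => by cases h)] at this
      exact absurd this zero_ne_one
    · unfold Troubled
      rw [C.isAndOp_redirect_iff_of_not_reads k₀ hv hk, hargs,
        C.fanout_redirect_of_ne k₀ (.const c) neg hv (u := .gate k) (fun h => hkk (Node.gate.inj h))
          (fun h => by cases h)]
      constructor
      · rintro ⟨hand, h1, x, y, hxy, hr, hx, hy⟩
        rw [C.fanout_redirect_of_ne k₀ _ neg hv (by simp) (fun h => by cases h)] at hx hy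
        exact ⟨hand, h1, x, y, hxy, hr, hx, hy⟩
      · rintro ⟨hand, h1, x, y, hxy, hr, hx, hy⟩
        refine ⟨hand, h1, x, y, hxy, hr, ?_, ?_⟩
        · rw [C.fanout_redirect_of_ne k₀ _ neg hv (by simp) (fun h => by cases h)]; exact hx
        · rw [C.fanout_redirect_of_ne k₀ _ neg hv (by simp) (fun h => by cases h)]; exact hy

/-- The measure is unchanged by redirecting the wires of a non-troubled gate to a constant,
with the same packing (which stays a packing). [cite: LiYang2022, Def. 3.6] -/
theorem measure_redirect_const' (hk₀ : ¬ C.Troubled k₀) (c neg : Bool) (αφ αI αQ : ℝ)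
    {P : Finset (Fin C.m × Fin C.m)} (hP : C.IsPacking P) (R : RdqSource n) :
    (C.redirect k₀ (.const c) neg (C.redirectOK_const k₀ c)).IsPacking P ∧
    (C.redirect k₀ (.const c) neg (C.redirectOK_const k₀ c)).measure αφ αI αQ P R =
      C.measure αφ αI αQ P R := by
  classical
  have hT : (C.redirect k₀ (.const c) neg (C.redirectOK_const k₀ c)).troubledCount = C.troubledCount := by
    unfold troubledCount
    exact congrArg Finset.card (filter_congr fun k _ => C.troubled_redirect_const_iff' k₀ hk₀ c neg k)
  refine ⟨⟨fun p hp => ?_, hP.2⟩, ?_⟩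
  · obtain ⟨hne, hT1, hT2, z, hz1, hz2⟩ := hP.1 p hp
    refine ⟨hne, (C.troubled_redirect_const_iff' k₀ hk₀ c neg _).mpr hT1,
      (C.troubled_redirect_const_iff' k₀ hk₀ c neg _).mpr hT2, z, ?_, ?_⟩
    · rw [C.redirect_arg_of_troubled k₀ _ hT1]; exact hz1
    · rw [C.redirect_arg_of_troubled k₀ _ hT2]; exact hz2
  · unfold measure potential
    rw [hT, C.influential_redirect_const k₀]

/-- A gate whose two wires coincide is not troubled (troubled gates read two distinct
variables). [cite: LiYang2022, Def. 3.1] -/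
theorem not_troubled_of_coincide {D : Semicircuit n} {k : Fin D.m} (h : D.arg k 0 = D.arg k 1) :
    ¬ D.Troubled k := by
  rintro ⟨-, -, x, y, hxy, hr, -, -⟩
  have hsub : Set.range (D.arg k) ⊆ {D.arg k 0} := by
    rintro u ⟨a, rfl⟩
    obtain rfl | rfl : a = 0 ∨ a = 1 := by fin_cases a <;> simp
    · rfl
    · exact h.symm
  rw [hr] at hsub
  have hx : Node.var x = D.arg k 0 := hsub (by simp)
  have hy : Node.var y = D.arg k 0 := hsub (by simp)
  exact hxy (Node.var.inj (hx.trans hy.symm))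

variable (a₀ : Fin 2) (neg : Bool) {m' : ℕ} (ε : Fin m' ≃ {k : Fin C.m // k ≠ k₀})

/-- **Out-degrees after bypassing, in general**: a variable or gate node `u ≠ k₀` loses its wires
into `k₀` and, if it is the target, inherits the `d` wires out of `k₀`. [cite: LiYang2022, §3.3 (Rules 3, 5)] -/
theorem fanout_bypass_add (hself : ∀ a, C.arg k₀ a ≠ .gate k₀) {u : Node n C.m} (huk : u ≠ .gate k₀) :
    (C.bypass k₀ a₀ neg ε).fanout (u.skip k₀ ε) + (univ.filter fun a : Fin 2 => C.arg k₀ a = u).card =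
      if C.arg k₀ a₀.rev = u then C.fanout u + C.fanout (.gate k₀) else C.fanout u := by
  have hlive : C.arg k₀ a₀.rev ≠ .gate k₀ := hself _
  have h1 := (C.redirect k₀ (C.arg k₀ a₀.rev) neg (C.redirectOK_live k₀ a₀)).fanout_removeGate_add k₀ ε
    (C.not_reads_redirect_live neg hlive) (v := u) huk
  have hw : (univ.filter fun a : Fin 2 =>
      (C.redirect k₀ (C.arg k₀ a₀.rev) neg (C.redirectOK_live k₀ a₀)).arg k₀ a = u) =
      univ.filter fun a : Fin 2 => C.arg k₀ a = u := by
    ext a; simp only [mem_filter, mem_univ, true_and]; rw [if_neg (hself a)]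
  rw [hw] at h1
  rw [h1]
  split_ifs with h
  · rw [← h, C.fanout_redirect_target k₀ _ neg _ hlive]
  · exact C.fanout_redirect_of_ne k₀ _ neg _ huk (Ne.symm h)

/-- **New troubled gates after bypassing are caused by one of the two inputs of `k₀`.**
[cite: LiYang2022, §3.3 (Rules 3, 5)] -/
theorem causedBy_of_new_troubled_bypass (hself : ∀ a, C.arg k₀ a ≠ .gate k₀) {k : Fin m'}
    (hT' : (C.bypass k₀ a₀ neg ε).Troubled k) (hT : ¬ C.Troubled (ε k)) :
    CausedBy C (C.bypass k₀ a₀ neg ε) (fun k => (ε k : Fin C.m)) (C.arg k₀ a₀.rev) k ∨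
      CausedBy C (C.bypass k₀ a₀ neg ε) (fun k => (ε k : Fin C.m)) (C.arg k₀ a₀) k := by
  by_contra hcon
  rw [not_or] at hcon
  obtain ⟨hcv, hcw⟩ := hcon
  unfold CausedBy at hcv hcw
  push Not at hcv hcw
  obtain ⟨hand, h1, x, y, hxy, hr, hx, hy⟩ := hT'
  -- `ε k` does not read `k₀`
  have hnr : ∀ a, C.arg (ε k) a ≠ .gate k₀ := by
    intro a ha
    have hmem : (C.bypass k₀ a₀ neg ε).arg k a ∈ Set.range ((C.bypass k₀ a₀ neg ε).arg k) := ⟨a, rfl⟩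
    rw [hr, bypass_arg, if_pos ha] at hmem
    rcases hmem with h | h
    · have hv := (Node.skip_eq_var_iff k₀ ε).mp h
      exact hcv.2 x hv a (by rw [bypass_arg, if_pos ha, hv]; rfl)
    · rw [Set.mem_singleton_iff] at h
      have hv := (Node.skip_eq_var_iff k₀ ε).mp h
      exact hcv.2 y hv a (by rw [bypass_arg, if_pos ha, hv]; rfl)
  have hargs₁ : (C.redirect k₀ (C.arg k₀ a₀.rev) neg (C.redirectOK_live k₀ a₀)).arg (ε k) = C.arg (ε k) := by
    funext a; rw [redirect_arg, if_neg (hnr a)]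
  have hr' : Set.range (C.arg (ε k)) = {Node.var x, Node.var y} := by
    have := ((C.redirect k₀ (C.arg k₀ a₀.rev) neg (C.redirectOK_live k₀ a₀)).range_arg_removeGate_eq_pair_iff
      k₀ ε k x y).mp hr
    rwa [hargs₁] at this
  have hreads₂ : ∀ {z}, (∃ a', C.arg (ε k) a' = .var z) → ∃ a', (C.bypass k₀ a₀ neg ε).arg k a' = .var z :=
    fun h => C.reads_var_bypass_of_reads neg ε h
  have hxr : ∃ a', C.arg (ε k) a' = .var x := by
    have : (Node.var x : Node n C.m) ∈ Set.range (C.arg (ε k)) := by rw [hr']; simp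
    exact this
  have hyr : ∃ a', C.arg (ε k) a' = .var y := by
    have : (Node.var y : Node n C.m) ∈ Set.range (C.arg (ε k)) := by rw [hr']; simp
    exact this
  -- no wire of `k₀` goes to the gate `ε k` or to the variables `x`, `y`
  have hwires : ∀ (u : Node n C.m), (u = .gate (ε k : Fin C.m) ∨ u = .var x ∨ u = .var y) →
      (univ.filter fun a : Fin 2 => C.arg k₀ a = u).card = 0 ∧ C.arg k₀ a₀.rev ≠ u := by
    intro u hu
    have hv : C.arg k₀ a₀.rev ≠ u := by
      rcases hu with rfl | rfl | rfl
      · exact hcv.1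
      · exact fun h => (hxr.elim fun a' ha' => hcv.2 x h _ (hreads₂ ⟨a', ha'⟩).choose_spec)
      · exact fun h => (hyr.elim fun a' ha' => hcv.2 y h _ (hreads₂ ⟨a', ha'⟩).choose_spec)
    have hw : C.arg k₀ a₀ ≠ u := by
      rcases hu with rfl | rfl | rfl
      · exact hcw.1
      · exact fun h => (hxr.elim fun a' ha' => hcw.2 x h _ (hreads₂ ⟨a', ha'⟩).choose_spec)
      · exact fun h => (hyr.elim fun a' ha' => hcw.2 y h _ (hreads₂ ⟨a', ha'⟩).choose_spec)
    refine ⟨?_, hv⟩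
    rw [card_eq_zero, filter_eq_empty_iff]
    intro a _ ha
    obtain rfl | rfl : a₀ = 0 ∨ a₀ = 1 := by fin_cases a₀ <;> simp
    · obtain rfl | rfl : a = 0 ∨ a = 1 := by fin_cases a <;> simp
      · exact hw ha
      · exact hv ha
    · obtain rfl | rfl : a = 0 ∨ a = 1 := by fin_cases a <;> simp
      · exact hv ha
      · exact hw ha
  apply hT
  refine ⟨(C.isAndOp_redirect_iff_of_not_reads k₀ (v := C.arg k₀ a₀.rev) (neg := neg)
    (C.redirectOK_live k₀ a₀) hnr).mp hand, ?_, x, y, hxy, hr', ?_, ?_⟩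
  · obtain ⟨hc, hv⟩ := hwires _ (Or.inl rfl)
    have := C.fanout_bypass_add k₀ a₀ neg ε hself (u := .gate (ε k : Fin C.m)) (fun h => (ε k).2 (Node.gate.inj h))
    rw [hc, add_zero, if_neg hv] at this
    rw [← this]; simpa using h1
  · obtain ⟨hc, hv⟩ := hwires _ (Or.inr (Or.inl rfl))
    have := C.fanout_bypass_add k₀ a₀ neg ε hself (u := .var x) (fun h => by cases h)
    rw [hc, add_zero, if_neg hv] at this
    rw [← this]; simpa using hx
  · obtain ⟨hc, hv⟩ := hwires _ (Or.inr (Or.inr rfl))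
    have := C.fanout_bypass_add k₀ a₀ neg ε hself (u := .var y) (fun h => by cases h)
    rw [hc, add_zero, if_neg hv] at this
    rw [← this]; simpa using hy

/-- **Bypass accounting through the transfer lemma**: `Φ' ≤ Φ + 2` in general, `Φ' ≤ Φ + 1`
when the other wire of `k₀` coincides with the target or is a constant (Rules 5 and 3).
[cite: LiYang2022, §3.3 (Rules 3, 5)] -/
theorem exists_packing_bypass_le (hself : ∀ a, C.arg k₀ a ≠ .gate k₀) (hk₀ : ¬ C.Troubled k₀)
    {P : Finset (Fin C.m × Fin C.m)} (hP : C.IsPacking P) :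
    ∃ P' : Finset (Fin m' × Fin m'), (C.bypass k₀ a₀ neg ε).IsPacking P' ∧
      (C.bypass k₀ a₀ neg ε).potential P' ≤ C.potential P +
        (if C.arg k₀ a₀ = C.arg k₀ a₀.rev ∨ ∃ b, C.arg k₀ a₀ = .const b then 1 else 2) := by
  classical
  set C' := C.bypass k₀ a₀ neg ε
  set ι : Fin m' → Fin C.m := fun k => (ε k : Fin C.m) with hι
  have hιinj : Function.Injective ι := fun k k' h => ε.injective (Subtype.ext h)
  have himg : ∀ p ∈ P, (∃ k, ι k = p.1) ∧ ∃ k, ι k = p.2 := by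
    intro p hp
    obtain ⟨-, hT1, hT2, -⟩ := hP.1 p hp
    have h1 : p.1 ≠ k₀ := fun h => hk₀ (h ▸ hT1)
    have h2 : p.2 ≠ k₀ := fun h => hk₀ (h ▸ hT2)
    exact ⟨⟨ε.symm ⟨p.1, h1⟩, by simp [hι]⟩, ⟨ε.symm ⟨p.2, h2⟩, by simp [hι]⟩⟩
  have hadj : ∀ k k', C'.Troubled k → C'.Troubled k' → C.Troubled (ι k) → C.Troubled (ι k') →
      C.Adjacent (ι k) (ι k') → C'.Adjacent k k' := fun k k' _ _ _ _ h => C.adjacent_bypass_of neg ε k k' h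
  set A : Finset (Fin m') := univ.filter fun k => C'.Troubled k ∧ CausedBy C C' ι (C.arg k₀ a₀.rev) k with hA
  set B : Finset (Fin m') := univ.filter fun k => C'.Troubled k ∧ CausedBy C C' ι (C.arg k₀ a₀) k with hB
  have hAgood : C'.GoodCover A := goodCover_causedBy C C' ι hιinj _ A fun k hk => (mem_filter.mp hk).2
  have hBgood : C'.GoodCover B := goodCover_causedBy C C' ι hιinj _ B fun k hk => (mem_filter.mp hk).2
  have hcover : ∀ k, C'.Troubled k → ¬ C.Troubled (ι k) → k ∈ A ∨ k ∈ B := by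
    intro k hk hkT
    rcases C.causedBy_of_new_troubled_bypass k₀ a₀ neg ε hself hk hkT with h | h
    · exact Or.inl (mem_filter.mpr ⟨mem_univ _, hk, h⟩)
    · exact Or.inr (mem_filter.mpr ⟨mem_univ _, hk, h⟩)
  split_ifs with hcase
  · have hcover' : ∀ k, C'.Troubled k → ¬ C.Troubled (ι k) → k ∈ (A ∪ B) ∨ k ∈ (∅ : Finset (Fin m')) :=
      fun k hk hkT => Or.inl (mem_union.mpr (hcover k hk hkT))
    have hgood : C'.GoodCover (A ∪ B) := by
      rcases hcase with heq | ⟨b, hb⟩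
      · have : B = A := by rw [hA, hB, heq]
        rw [this, union_idempotent]; exact hAgood
      · have : B = ∅ := by
          rw [hB, filter_eq_empty_iff]
          rintro k - ⟨-, h | ⟨z, h, -⟩⟩ <;> rw [hb] at h <;> cases h
        rw [this, union_empty]; exact hAgood
    obtain ⟨P', hP', hpot⟩ := exists_packing_transfer C C' ι hιinj hP himg hadj (A ∪ B) ∅ hcover' hgood
      (Or.inl (by simp))
    refine ⟨P', hP', hpot.trans ?_⟩
    have h1 : ((if A ∪ B = ∅ then 0 else 1 : ℕ) : ℝ) ≤ 1 := by exact_mod_cast ite_empty_le_one (A ∪ B)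
    have h2 : ((if (∅ : Finset (Fin m')) = ∅ then 0 else 1 : ℕ) : ℝ) = 0 := by simp
    linarith
  · obtain ⟨P', hP', hpot⟩ := exists_packing_transfer C C' ι hιinj hP himg hadj A B hcover hAgood hBgood
    refine ⟨P', hP', hpot.trans ?_⟩
    have hA1 : ((if A = ∅ then 0 else 1 : ℕ) : ℝ) ≤ 1 := by exact_mod_cast ite_empty_le_one A
    have hB1 : ((if B = ∅ then 0 else 1 : ℕ) : ℝ) ≤ 1 := by exact_mod_cast ite_empty_le_one B
    linarith

/-- Influential inputs do not appear when bypassing (general form). [cite: LiYang2022, Def. 3.6] -/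
theorem influential_bypass_subset' (hself : ∀ a, C.arg k₀ a ≠ .gate k₀) (R : RdqSource n) :
    (C.bypass k₀ a₀ neg ε).influential R ⊆ C.influential R := by
  classical
  intro i hi
  unfold influential at hi ⊢
  rw [mem_filter] at hi ⊢
  refine ⟨mem_univ _, hi.2.imp_left fun h => ?_⟩
  by_cases hiv : C.arg k₀ a₀.rev = .var i
  · unfold fanout
    refine Nat.one_le_iff_ne_zero.mpr fun hsum => ?_
    have := (sum_eq_zero_iff.mp hsum) k₀ (mem_univ _)
    rw [card_eq_zero, filter_eq_empty_iff] at this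
    exact this (mem_univ _) hiv
  · have := C.fanout_bypass_add k₀ a₀ neg ε hself (u := .var i) (fun h => by cases h)
    rw [if_neg hiv, Node.skip_var] at this
    omega

/-- **Rule 5** (Li–Yang Lemma 3.11): a gate `k₀` whose two wires go to the same node
`u ≠ k₀`, not the output, can be eliminated from a fair semicircuit computing `f|_R` with a
packing, with `Δμ ≥ 1 - α_φ`: its value is `ψ(u)` with `ψ t = op t t`; if `ψ` is constant its
readers read that constant and the `0`-gate is deleted (Rule 1 with coinciding wires),
otherwise it is bypassed to `u`. (The paper: "we make it degenerate (or trivial) by changing one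
(or both) of its input to a constant, and eliminate it via Rule 2 or Rule 3"; the count `ΔΦ ≤ 1`
is that all new troubled gates are caused by `u`.) [cite: LiYang2022, Lemma 3.11 (Rule 5)] -/
theorem rule5 {f : (Fin n → ZMod 2) → Bool} {R : RdqSource n} (hF : C.Fair)
    (hC : C.ComputesRestr f R) {P : Finset (Fin C.m × Fin C.m)} (hP : C.IsPacking P)
    (hco : C.arg k₀ 0 = C.arg k₀ 1) (hself : ∀ a, C.arg k₀ a ≠ .gate k₀) (hout : C.out ≠ .gate k₀)
    {αφ αI : ℝ} (hφ : 0 ≤ αφ) (hI : 0 ≤ αI) (αQ : ℝ) :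
    ∃ (C' : Semicircuit n) (P' : Finset (Fin C'.m × Fin C'.m)), C'.Fair ∧ C'.ComputesRestr f R ∧
      C'.IsPacking P' ∧ C'.m + 1 = C.m ∧
      C'.measure αφ αI αQ P' R ≤ C.measure αφ αI αQ P R - (1 - αφ) := by
  have hk₀ : ¬ C.Troubled k₀ := not_troubled_of_coincide hco
  set ψ : Bool → Bool := fun t => C.op k₀ t t with hψ
  have hid0 : ∀ (x : Fin n → Bool) (w : Fin C.m → Bool),
      C.op k₀ (C.nodeVal x w (C.arg k₀ 0)) (C.nodeVal x w (C.arg k₀ 1)) = ψ (C.nodeVal x w (C.arg k₀ 1)) := by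
    intro x w; rw [hco]
  rcases bool_fn_const_or_xor ψ with htriv | hdeg
  · -- trivialized: readers read the constant, then Rule 1 with coinciding wires
    set c := ψ false with hc
    have hv := C.redirectOK_const k₀ c
    have hid : ∀ (x : Fin n → Bool) (w : Fin C.m → Bool),
        C.op k₀ (C.nodeVal x w (C.arg k₀ 0)) (C.nodeVal x w (C.arg k₀ 1)) =
          (C.nodeVal x w (.const c) ^^ false) := by
      intro x w
      rw [hid0, Bool.xor_false]
      show _ = c
      cases C.nodeVal x w (C.arg k₀ 1)
      · rfl
      · exact htriv.symm
    set C₁ := C.redirect k₀ (.const c) false hv with hC₁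
    have hF₁ : C₁.Fair := hF.redirect hself hid
    have hC₁' : C₁.ComputesRestr f R := hC.redirect hself hid (fun i h => by cases h)
    obtain ⟨hP₁, hμ₁⟩ := C.measure_redirect_const' k₀ hk₀ c false αφ αI αQ hP R
    have h0₁ : C₁.fanout (.gate k₀) = 0 := C.fanout_redirect_self k₀ _ false hv (fun h => by cases h)
    have hco₁ : C₁.arg k₀ 0 = C₁.arg k₀ 1 := by
      show (if C.arg k₀ 0 = .gate k₀ then Node.const c else C.arg k₀ 0) =
        (if C.arg k₀ 1 = .gate k₀ then Node.const c else C.arg k₀ 1)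
      rw [if_neg (hself 0), if_neg (hself 1), hco]
    obtain ⟨C', P', hF', hC', hP', hm, hμ⟩ :=
      C₁.rule1_of_coincide k₀ hF₁ hC₁' hP₁ h0₁ hout hco₁ hφ hI αQ
    exact ⟨C', P', hF', hC', hP', hm, by linarith⟩
  · -- degenerate: bypass to `u`
    set neg := ψ false
    have hv := C.redirectOK_live k₀ 0
    have hrev : (0 : Fin 2).rev = 1 := rfl
    have hid : ∀ (x : Fin n → Bool) (w : Fin C.m → Bool),
        C.op k₀ (C.nodeVal x w (C.arg k₀ 0)) (C.nodeVal x w (C.arg k₀ 1)) =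
          (C.nodeVal x w (C.arg k₀ (0 : Fin 2).rev) ^^ neg) := by
      intro x w; rw [hid0, hdeg, hrev]
    have hlive : C.arg k₀ (0 : Fin 2).rev ≠ .gate k₀ := hself _
    set C₁ := C.redirect k₀ (C.arg k₀ (0 : Fin 2).rev) neg hv with hC₁
    have hF₁ : C₁.Fair := hF.redirect hself hid
    have hC₁' : C₁.ComputesRestr f R := hC.redirect hself hid fun i h => ⟨_, h⟩
    have h0₁ : ∀ k a, C₁.arg k a ≠ .gate k₀ := C.not_reads_redirect_live neg hlive
    set ε := C.skipEquiv k₀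
    obtain ⟨P', hP', hpot⟩ := C.exists_packing_bypass_le k₀ 0 neg ε hself hk₀ hP
    rw [if_pos (Or.inl (by rw [hrev]; exact hco))] at hpot
    refine ⟨C.bypass k₀ 0 neg ε, P', Fair.removeGate (C := C₁) ε hF₁ h0₁,
      ComputesRestr.removeGate (C := C₁) ε hC₁' hF₁ h0₁ hout, hP', C₁.removeGate_m_add_one k₀ ε, ?_⟩
    have hinf : (((C.bypass k₀ 0 neg ε).influential R).card : ℝ) ≤ (C.influential R).card := by
      exact_mod_cast card_le_card (C.influential_bypass_subset' k₀ 0 neg ε hself R)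
    have hm : (((C.m - 1 : ℕ) : ℝ)) + 1 = C.m := by exact_mod_cast C₁.removeGate_m_add_one k₀ ε
    unfold measure
    show ((C.m - 1 : ℕ) : ℝ) + _ + _ + _ ≤ _
    nlinarith [mul_le_mul_of_nonneg_left hinf hI, mul_le_mul_of_nonneg_left hpot hφ]

end Rule5

end Semicircuit

end Literature.Computability.Complexity
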